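import Summits.AtomisticToContinuum.Crystallization.Theorems.ExcessDecayLiouvilleKLipschitz
import Summits.AtomisticToContinuum.Crystallization.Theorems.ExcessDecayLiouvilleHcpLiouvilleAnchorNewton

/-!
# `ExcessDecayLiouville.HcpLiouville` (stmt-AtomisticToContinuum-9332), line `Sketch` (skeleton v4): second differences of the force-constant kernel

Helper for stub `stub_interior` (step (3) of the interior estimate for `L`-harmonic fields): the exterior of the
localisation ball acts on the lattice differences of the localised field only through DIFFERENCES of the kernel
`K = forceConst` (`K(w) = h(|w|²)·1 + 2h′(|w|²)·(w ⊗ w)`, `h(x) = −x⁻⁷ + x⁻⁴`).  The first difference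
`‖K(e+a) − K(e)‖ ≲ |e|⁻⁹|a|` is `norm_forceConst_shift_sub_le` (…KLipschitz, restated as
`Blowdown.norm_forceConst_diff₁_le`); here we add `‖K(e+a+b) − K(e+a) − K(e+b) + K(e)‖ ≤ 2·10⁷|e|⁻¹⁰(|a| + |b|)²`
(`Blowdown.norm_forceConst_diff₂_le`, registered carrier `blowdown_kernelDiff`) from the second-order Taylor bound
`Blowdown.norm_forceConst_taylor_le` of `s ↦ K(e+s)w` (seven-piece decomposition `Blowdown.forceConst_taylor_identity`,
profile bounds `Blowdown.abs_taylor_h'_le`; the linear part is additive in `s` and cancels in the second difference).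
All `[folklore]`; a `--supports` helper for item stmt-AtomisticToContinuum-9332, nothing here closes an item.
-/

noncomputable section

namespace Summit.AtomisticToContinuum.Crystallization.Theorems.ExcessDecayLiouville

open scoped BigOperators Topology Classical InnerProductSpace RealInnerProductSpace
open Literature.MathematicalPhysics.StatisticalMechanics
open Summit.AtomisticToContinuum.Crystallization.Theses.ExcessDecayLiouville
open Summit.AtomisticToContinuum.Crystallization.Theorems.PhononStabilityNegative

namespace Blowdown

/-! ## The third derivative of the profile and the Taylor bound for `h′` -/

/-- `h″(x) = −56x⁻⁹ + 20x⁻⁶` has derivative `h‴(x) = 504x⁻¹⁰ − 120x⁻⁷` (`x ≠ 0`). [folklore] -/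
theorem hasDerivAt_ljProfile'' {x : ℝ} (hx : x ≠ 0) :
    HasDerivAt (fun y : ℝ => -56 * (y⁻¹) ^ 9 + 20 * (y⁻¹) ^ 6) (504 * (x⁻¹) ^ 10 - 120 * (x⁻¹) ^ 7) x := by
  have h1 : HasDerivAt (fun y : ℝ => y⁻¹) (-(x ^ 2)⁻¹) x := hasDerivAt_inv hx
  refine (((h1.pow 9).const_mul (-56)).add ((h1.pow 6).const_mul 20)).congr_deriv ?_
  rw [← inv_pow]
  ring

/-- **Mean-value bound for `h″`** on `[m, ∞)`: `|h″(y) − h″(x)| ≤ (504m⁻¹⁰ + 120m⁻⁷)|y − x|`. [folklore] -/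
theorem abs_h''_sub_h''_le {m x y : ℝ} (hm : 0 < m) (hx : m ≤ x) (hy : m ≤ y) :
    |(-56 * (y⁻¹) ^ 9 + 20 * (y⁻¹) ^ 6) - (-56 * (x⁻¹) ^ 9 + 20 * (x⁻¹) ^ 6)| ≤
      (504 * (m⁻¹) ^ 10 + 120 * (m⁻¹) ^ 7) * |y - x| := by
  have hderiv : ∀ z ∈ Set.Ici m, HasDerivWithinAt (fun y : ℝ => -56 * (y⁻¹) ^ 9 + 20 * (y⁻¹) ^ 6)
      (504 * (z⁻¹) ^ 10 - 120 * (z⁻¹) ^ 7) (Set.Ici m) z :=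
    fun z hz => (hasDerivAt_ljProfile'' (hm.trans_le hz).ne').hasDerivWithinAt
  have hbound : ∀ z ∈ Set.Ici m, ‖504 * (z⁻¹) ^ 10 - 120 * (z⁻¹) ^ 7‖ ≤ 504 * (m⁻¹) ^ 10 + 120 * (m⁻¹) ^ 7 := by
    intro z hz
    have hz0 : 0 < z := hm.trans_le hz
    have hzi : z⁻¹ ≤ m⁻¹ := inv_anti₀ hm hz
    have hzi0 : 0 ≤ z⁻¹ := inv_nonneg.2 hz0.le
    have h10 : (z⁻¹) ^ 10 ≤ (m⁻¹) ^ 10 := pow_le_pow_left₀ hzi0 hzi 10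
    have h7 : (z⁻¹) ^ 7 ≤ (m⁻¹) ^ 7 := pow_le_pow_left₀ hzi0 hzi 7
    rw [Real.norm_eq_abs]
    refine abs_le.2 ⟨?_, ?_⟩ <;> nlinarith [pow_nonneg hzi0 10, pow_nonneg hzi0 7]
  have := (convex_Ici m).norm_image_sub_le_of_norm_hasDerivWithin_le hderiv hbound hx hy
  simpa only [Real.norm_eq_abs] using this

/-- **Second-order Taylor bound for `h′`** on `[m, ∞)`:
`|h′(y) − h′(x) − h″(x)(y − x)| ≤ (504m⁻¹⁰ + 120m⁻⁷)(y − x)²`. [folklore] -/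
theorem abs_taylor_h'_le {m x y : ℝ} (hm : 0 < m) (hx : m ≤ x) (hy : m ≤ y) :
    |(7 * (y⁻¹) ^ 8 - 4 * (y⁻¹) ^ 5) - (7 * (x⁻¹) ^ 8 - 4 * (x⁻¹) ^ 5) -
        (-56 * (x⁻¹) ^ 9 + 20 * (x⁻¹) ^ 6) * (y - x)| ≤
      (504 * (m⁻¹) ^ 10 + 120 * (m⁻¹) ^ 7) * (y - x) ^ 2 := by
  set a := min x y with ha
  set b := max x y with hb
  have hma : m ≤ a := le_min hx hy
  have hseg : ∀ z ∈ Set.Icc a b, |z - x| ≤ |y - x| := by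
    intro z hz
    rcases le_total x y with hxy | hxy
    · have h1 : a = x := by rw [ha, min_eq_left hxy]
      have h2 : b = y := by rw [hb, max_eq_right hxy]
      rw [h1, h2] at hz
      rw [abs_of_nonneg (by linarith [hz.1]), abs_of_nonneg (by linarith)]
      linarith [hz.2]
    · have h1 : a = y := by rw [ha, min_eq_right hxy]
      have h2 : b = x := by rw [hb, max_eq_left hxy]
      rw [h1, h2] at hz
      rw [abs_of_nonpos (by linarith [hz.2]), abs_of_nonpos (by linarith)]
      linarith [hz.1]
  set L := 504 * (m⁻¹) ^ 10 + 120 * (m⁻¹) ^ 7 with hL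
  have hL0 : 0 ≤ L := by positivity
  have hderiv : ∀ z ∈ Set.Icc a b, HasDerivWithinAt
      (fun ξ : ℝ => (7 * (ξ⁻¹) ^ 8 - 4 * (ξ⁻¹) ^ 5) - (-56 * (x⁻¹) ^ 9 + 20 * (x⁻¹) ^ 6) * ξ)
      ((-56 * (z⁻¹) ^ 9 + 20 * (z⁻¹) ^ 6) - (-56 * (x⁻¹) ^ 9 + 20 * (x⁻¹) ^ 6)) (Set.Icc a b) z := by
    intro z hz
    have hz0 : z ≠ 0 := (hm.trans_le (hma.trans hz.1)).ne'
    have h1 := hasDerivAt_ljProfile' hz0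
    have h2 : HasDerivAt (fun ξ : ℝ => (-56 * (x⁻¹) ^ 9 + 20 * (x⁻¹) ^ 6) * ξ)
        (-56 * (x⁻¹) ^ 9 + 20 * (x⁻¹) ^ 6) z := by
      simpa only [mul_one, id] using (hasDerivAt_id z).const_mul (-56 * (x⁻¹) ^ 9 + 20 * (x⁻¹) ^ 6)
    exact (h1.sub h2).hasDerivWithinAt
  have hbound : ∀ z ∈ Set.Icc a b,
      ‖(-56 * (z⁻¹) ^ 9 + 20 * (z⁻¹) ^ 6) - (-56 * (x⁻¹) ^ 9 + 20 * (x⁻¹) ^ 6)‖ ≤ L * |y - x| := by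
    intro z hz
    rw [Real.norm_eq_abs]
    have h1 := abs_h''_sub_h''_le hm hx (hma.trans hz.1)
    exact h1.trans (mul_le_mul_of_nonneg_left (hseg z hz) hL0)
  have hxs : x ∈ Set.Icc a b := ⟨min_le_left _ _, le_max_left _ _⟩
  have hys : y ∈ Set.Icc a b := ⟨min_le_right _ _, le_max_right _ _⟩
  have hmv := (convex_Icc a b).norm_image_sub_le_of_norm_hasDerivWithin_le hderiv hbound hxs hys
  rw [Real.norm_eq_abs, Real.norm_eq_abs] at hmv
  have hid : (7 * (y⁻¹) ^ 8 - 4 * (y⁻¹) ^ 5) - (-56 * (x⁻¹) ^ 9 + 20 * (x⁻¹) ^ 6) * y -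
      ((7 * (x⁻¹) ^ 8 - 4 * (x⁻¹) ^ 5) - (-56 * (x⁻¹) ^ 9 + 20 * (x⁻¹) ^ 6) * x) =
      (7 * (y⁻¹) ^ 8 - 4 * (y⁻¹) ^ 5) - (7 * (x⁻¹) ^ 8 - 4 * (x⁻¹) ^ 5) -
        (-56 * (x⁻¹) ^ 9 + 20 * (x⁻¹) ^ 6) * (y - x) := by
    ring
  rw [hid] at hmv
  calc _ ≤ L * |y - x| * |y - x| := hmv
    _ = L * (y - x) ^ 2 := by rw [mul_assoc, ← abs_mul, ← sq, abs_of_nonneg (sq_nonneg _)]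

/-! ## The second-order Taylor decomposition of `s ↦ K(e+s)w` -/

/-- **The seven-piece decomposition** of `K(e+s)w − K(e)w − K′(e)[s]w` for generic profile functions
`hh, hh′, hh″` (with `Y = |e+s|²`, `X = |e|²`; the pieces carry the Taylor remainders of `hh`, `hh′` and the
defect `Y − X − 2⟪e,s⟫ = |s|²`). [folklore] -/
theorem forceConst_taylor_identity (e s w : EuclideanSpace ℝ (Fin 3)) (hh hh' hh'' : ℝ → ℝ) :
    hh (‖e + s‖ ^ 2) • w + (2 * ⟪e + s, w⟫ * hh' (‖e + s‖ ^ 2)) • (e + s) -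
        (hh (‖e‖ ^ 2) • w + (2 * ⟪e, w⟫ * hh' (‖e‖ ^ 2)) • e) -
        ((hh' (‖e‖ ^ 2) * (2 * ⟪e, s⟫)) • w + (2 * ⟪s, w⟫ * hh' (‖e‖ ^ 2)) • e +
          (2 * ⟪e, w⟫ * (hh'' (‖e‖ ^ 2) * (2 * ⟪e, s⟫))) • e + (2 * ⟪e, w⟫ * hh' (‖e‖ ^ 2)) • s) =
      (hh (‖e + s‖ ^ 2) - hh (‖e‖ ^ 2) - hh' (‖e‖ ^ 2) * (‖e + s‖ ^ 2 - ‖e‖ ^ 2)) • w +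
        (hh' (‖e‖ ^ 2) * (‖e + s‖ ^ 2 - ‖e‖ ^ 2 - 2 * ⟪e, s⟫)) • w +
        (2 * ⟪s, w⟫ * (hh' (‖e + s‖ ^ 2) - hh' (‖e‖ ^ 2))) • (e + s) +
        (2 * ⟪s, w⟫ * hh' (‖e‖ ^ 2)) • s +
        (2 * ⟪e, w⟫ * (hh' (‖e + s‖ ^ 2) - hh' (‖e‖ ^ 2) - hh'' (‖e‖ ^ 2) * (‖e + s‖ ^ 2 - ‖e‖ ^ 2))) • (e + s) +
        (2 * ⟪e, w⟫ * (hh'' (‖e‖ ^ 2) * (‖e + s‖ ^ 2 - ‖e‖ ^ 2 - 2 * ⟪e, s⟫))) • (e + s) +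
        (2 * ⟪e, w⟫ * (hh'' (‖e‖ ^ 2) * (2 * ⟪e, s⟫))) • s := by
  rw [inner_add_left]
  module

/-- The scalar bookkeeping behind `norm_forceConst_taylor_le`: with `E = |e| ≥ 1` and `M = (9E²/16)⁻¹`, the sum
of the seven piece constants is `≤ 10⁷ E⁻¹⁰`. [folklore] -/
theorem taylor_scalar_bound {E : ℝ} (hE : 1 ≤ E) :
    (56 * ((9 / 16 * E ^ 2)⁻¹) ^ 9 + 20 * ((9 / 16 * E ^ 2)⁻¹) ^ 6) * (81 / 16 * E ^ 2) +
      (7 * ((9 / 16 * E ^ 2)⁻¹) ^ 8 + 4 * ((9 / 16 * E ^ 2)⁻¹) ^ 5) +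
      2 * (56 * ((9 / 16 * E ^ 2)⁻¹) ^ 9 + 20 * ((9 / 16 * E ^ 2)⁻¹) ^ 6) * (9 / 4 * E) * (5 / 4 * E) +
      2 * (7 * ((9 / 16 * E ^ 2)⁻¹) ^ 8 + 4 * ((9 / 16 * E ^ 2)⁻¹) ^ 5) +
      2 * E * ((504 * ((9 / 16 * E ^ 2)⁻¹) ^ 10 + 120 * ((9 / 16 * E ^ 2)⁻¹) ^ 7) * (81 / 16 * E ^ 2)) *
        (5 / 4 * E) +
      2 * E * (56 * ((9 / 16 * E ^ 2)⁻¹) ^ 9 + 20 * ((9 / 16 * E ^ 2)⁻¹) ^ 6) * (5 / 4 * E) +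
      2 * E * ((56 * ((9 / 16 * E ^ 2)⁻¹) ^ 9 + 20 * ((9 / 16 * E ^ 2)⁻¹) ^ 6) * (2 * E)) ≤
      10000000 * (E⁻¹) ^ 10 := by
  have hE0 : 0 < E := by linarith
  have hmi : (9 / 16 * E ^ 2)⁻¹ = (16 / 9) * (E⁻¹) ^ 2 := by rw [mul_inv, inv_pow]; norm_num
  rw [hmi]
  set u := E⁻¹ with hu
  have hu0 : 0 < u := inv_pos.2 hE0
  have hue : u * E = 1 := by rw [hu, inv_mul_cancel₀ hE0.ne']
  have hu1 : u ≤ 1 := by rw [hu]; exact inv_le_one_of_one_le₀ hE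
  have hu16 : u ^ 16 ≤ u ^ 10 := pow_le_pow_of_le_one hu0.le hu1 (by norm_num)
  have e18 : ((16 / 9 : ℝ) * u ^ 2) ^ 9 * E ^ 2 = (16 / 9) ^ 9 * u ^ 16 := by
    have : u ^ 18 * E ^ 2 = u ^ 16 * (u * E) ^ 2 := by ring
    rw [mul_pow, ← pow_mul, show 2 * 9 = 18 by norm_num, mul_assoc, this, hue, one_pow, mul_one]
  have e12 : ((16 / 9 : ℝ) * u ^ 2) ^ 6 * E ^ 2 = (16 / 9) ^ 6 * u ^ 10 := by
    have : u ^ 12 * E ^ 2 = u ^ 10 * (u * E) ^ 2 := by ring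
    rw [mul_pow, ← pow_mul, show 2 * 6 = 12 by norm_num, mul_assoc, this, hue, one_pow, mul_one]
  have e16 : ((16 / 9 : ℝ) * u ^ 2) ^ 8 = (16 / 9) ^ 8 * u ^ 16 := by rw [mul_pow, ← pow_mul]
  have e10 : ((16 / 9 : ℝ) * u ^ 2) ^ 5 = (16 / 9) ^ 5 * u ^ 10 := by rw [mul_pow, ← pow_mul]
  have e20 : ((16 / 9 : ℝ) * u ^ 2) ^ 10 * E ^ 4 = (16 / 9) ^ 10 * u ^ 16 := by
    have : u ^ 20 * E ^ 4 = u ^ 16 * (u * E) ^ 4 := by ring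
    rw [mul_pow, ← pow_mul, show 2 * 10 = 20 by norm_num, mul_assoc, this, hue, one_pow, mul_one]
  have e14 : ((16 / 9 : ℝ) * u ^ 2) ^ 7 * E ^ 4 = (16 / 9) ^ 7 * u ^ 10 := by
    have : u ^ 14 * E ^ 4 = u ^ 10 * (u * E) ^ 4 := by ring
    rw [mul_pow, ← pow_mul, show 2 * 7 = 14 by norm_num, mul_assoc, this, hue, one_pow, mul_one]
  -- group the pieces by the monomials `M⁹E², M⁶E², M⁸, M⁵, M¹⁰E⁴, M⁷E⁴`
  have key : (56 * ((16 / 9 : ℝ) * u ^ 2) ^ 9 + 20 * ((16 / 9 : ℝ) * u ^ 2) ^ 6) * (81 / 16 * E ^ 2) +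
      (7 * ((16 / 9 : ℝ) * u ^ 2) ^ 8 + 4 * ((16 / 9 : ℝ) * u ^ 2) ^ 5) +
      2 * (56 * ((16 / 9 : ℝ) * u ^ 2) ^ 9 + 20 * ((16 / 9 : ℝ) * u ^ 2) ^ 6) * (9 / 4 * E) * (5 / 4 * E) +
      2 * (7 * ((16 / 9 : ℝ) * u ^ 2) ^ 8 + 4 * ((16 / 9 : ℝ) * u ^ 2) ^ 5) +
      2 * E * ((504 * ((16 / 9 : ℝ) * u ^ 2) ^ 10 + 120 * ((16 / 9 : ℝ) * u ^ 2) ^ 7) * (81 / 16 * E ^ 2)) *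
        (5 / 4 * E) +
      2 * E * (56 * ((16 / 9 : ℝ) * u ^ 2) ^ 9 + 20 * ((16 / 9 : ℝ) * u ^ 2) ^ 6) * (5 / 4 * E) +
      2 * E * ((56 * ((16 / 9 : ℝ) * u ^ 2) ^ 9 + 20 * ((16 / 9 : ℝ) * u ^ 2) ^ 6) * (2 * E)) =
      (81 / 16 + 45 / 8 + 5 / 2 + 4) * (56 * (((16 / 9 : ℝ) * u ^ 2) ^ 9 * E ^ 2) +
          20 * (((16 / 9 : ℝ) * u ^ 2) ^ 6 * E ^ 2)) +
        3 * (7 * ((16 / 9 : ℝ) * u ^ 2) ^ 8 + 4 * ((16 / 9 : ℝ) * u ^ 2) ^ 5) +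
        405 / 32 * (504 * (((16 / 9 : ℝ) * u ^ 2) ^ 10 * E ^ 4) + 120 * (((16 / 9 : ℝ) * u ^ 2) ^ 7 * E ^ 4)) := by
    ring
  rw [key, e18, e12, e16, e10, e20, e14]
  have hu10 : 0 ≤ u ^ 10 := by positivity
  nlinarith [hu16, hu10]

/-- **Second-order Taylor bound for the force-constant kernel in the bond**: for `|e| ≥ 1` and `|s| ≤ |e|/4`,
`‖K(e+s)w − K(e)w − K′(e)[s]w‖ ≤ 10⁷·|e|⁻¹⁰·|s|²·|w|`, where
`K′(e)[s]w = 2h′⟪e,s⟫w + 2h′⟪s,w⟫e + 4h″⟪e,w⟫⟪e,s⟫e + 2h′⟪e,w⟫s` (`h′, h″` at `|e|²`). [folklore] -/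
theorem norm_forceConst_taylor_le {e s : EuclideanSpace ℝ (Fin 3)} (he : 1 ≤ ‖e‖) (hs : ‖s‖ ≤ ‖e‖ / 4)
    (w : EuclideanSpace ℝ (Fin 3)) :
    ‖forceConst (e + s) w - forceConst e w -
        (((7 * ((‖e‖ ^ 2)⁻¹) ^ 8 - 4 * ((‖e‖ ^ 2)⁻¹) ^ 5) * (2 * ⟪e, s⟫)) • w +
          (2 * ⟪s, w⟫ * (7 * ((‖e‖ ^ 2)⁻¹) ^ 8 - 4 * ((‖e‖ ^ 2)⁻¹) ^ 5)) • e +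
          (2 * ⟪e, w⟫ * ((-56 * ((‖e‖ ^ 2)⁻¹) ^ 9 + 20 * ((‖e‖ ^ 2)⁻¹) ^ 6) * (2 * ⟪e, s⟫))) • e +
          (2 * ⟪e, w⟫ * (7 * ((‖e‖ ^ 2)⁻¹) ^ 8 - 4 * ((‖e‖ ^ 2)⁻¹) ^ 5)) • s)‖ ≤
      10000000 * (‖e‖⁻¹) ^ 10 * ‖s‖ ^ 2 * ‖w‖ := by
  have hid := forceConst_taylor_identity e s w (fun y => -(y⁻¹) ^ 7 + (y⁻¹) ^ 4)
    (fun y => 7 * (y⁻¹) ^ 8 - 4 * (y⁻¹) ^ 5) (fun y => -56 * (y⁻¹) ^ 9 + 20 * (y⁻¹) ^ 6)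
  rw [forceConst_apply, forceConst_apply, hid]
  have he0 : 0 < ‖e‖ := by linarith
  have hs0 : 0 ≤ ‖s‖ := norm_nonneg s
  have hw0 : 0 ≤ ‖w‖ := norm_nonneg w
  have he9 : 9 / 10 ≤ ‖e‖ := by linarith
  obtain ⟨hyx, hdiff, hea⟩ := shifted_bond_bounds hs
  have hsq : ‖e + s‖ ^ 2 - ‖e‖ ^ 2 - 2 * ⟪e, s⟫ = ‖s‖ ^ 2 := by
    rw [norm_add_sq_real]; ring
  rw [hsq]
  have hm0 : 0 < 9 / 16 * ‖e‖ ^ 2 := by positivity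
  have hmx : 9 / 16 * ‖e‖ ^ 2 ≤ ‖e‖ ^ 2 := by nlinarith
  obtain ⟨M, hM⟩ : ∃ M, (9 / 16 * ‖e‖ ^ 2)⁻¹ = M := ⟨_, rfl⟩
  have hM0 : 0 < M := by rw [← hM]; exact inv_pos.2 hm0
  have hxinv : (‖e‖ ^ 2)⁻¹ ≤ M := by rw [← hM]; exact inv_anti₀ hm0 hmx
  have hxinv0 : 0 ≤ (‖e‖ ^ 2)⁻¹ := by positivity
  have hh'x : |7 * ((‖e‖ ^ 2)⁻¹) ^ 8 - 4 * ((‖e‖ ^ 2)⁻¹) ^ 5| ≤ 7 * M ^ 8 + 4 * M ^ 5 := by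
    have h8 : ((‖e‖ ^ 2)⁻¹) ^ 8 ≤ M ^ 8 := pow_le_pow_left₀ hxinv0 hxinv 8
    have h5 : ((‖e‖ ^ 2)⁻¹) ^ 5 ≤ M ^ 5 := pow_le_pow_left₀ hxinv0 hxinv 5
    exact abs_le.2 ⟨by nlinarith [pow_nonneg hxinv0 8, pow_nonneg hxinv0 5],
      by nlinarith [pow_nonneg hxinv0 8, pow_nonneg hxinv0 5]⟩
  have hh''x : |-56 * ((‖e‖ ^ 2)⁻¹) ^ 9 + 20 * ((‖e‖ ^ 2)⁻¹) ^ 6| ≤ 56 * M ^ 9 + 20 * M ^ 6 := by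
    have h9 : ((‖e‖ ^ 2)⁻¹) ^ 9 ≤ M ^ 9 := pow_le_pow_left₀ hxinv0 hxinv 9
    have h6 : ((‖e‖ ^ 2)⁻¹) ^ 6 ≤ M ^ 6 := pow_le_pow_left₀ hxinv0 hxinv 6
    exact abs_le.2 ⟨by nlinarith [pow_nonneg hxinv0 9, pow_nonneg hxinv0 6],
      by nlinarith [pow_nonneg hxinv0 9, pow_nonneg hxinv0 6]⟩
  have hdiff2 : (‖e + s‖ ^ 2 - ‖e‖ ^ 2) ^ 2 ≤ (9 / 4 * ‖e‖ * ‖s‖) ^ 2 := by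
    rw [← sq_abs]
    exact pow_le_pow_left₀ (abs_nonneg _) hdiff 2
  have hT := abs_taylor_h_le hm0 hmx hyx
  have hT' := abs_taylor_h'_le hm0 hmx hyx
  have hD' := abs_h'_sub_h'_le hm0 hmx hyx
  rw [hM] at hT hT' hD'
  obtain ⟨y, hy⟩ : ∃ y, ‖e + s‖ ^ 2 = y := ⟨_, rfl⟩
  rw [hy] at hT hT' hD' hdiff hdiff2 ⊢
  obtain ⟨x, hx⟩ : ∃ x, ‖e‖ ^ 2 = x := ⟨_, rfl⟩
  rw [hx] at hT hT' hD' hdiff hdiff2 hh'x hh''x ⊢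
  have hisw := abs_real_inner_le_norm s w; have hiew := abs_real_inner_le_norm e w
  have hies := abs_real_inner_le_norm e s
  obtain ⟨hB0, hC0⟩ : 0 ≤ 56 * M ^ 9 + 20 * M ^ 6 ∧ 0 ≤ 504 * M ^ 10 + 120 * M ^ 7 := ⟨by positivity, by positivity⟩
  -- the seven pieces
  have n1 : ‖((-(y⁻¹) ^ 7 + (y⁻¹) ^ 4) - (-(x⁻¹) ^ 7 + (x⁻¹) ^ 4) - (7 * (x⁻¹) ^ 8 - 4 * (x⁻¹) ^ 5) * (y - x)) • w‖ ≤
      (56 * M ^ 9 + 20 * M ^ 6) * (81 / 16 * ‖e‖ ^ 2) * ‖s‖ ^ 2 * ‖w‖ := by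
    rw [norm_smul, Real.norm_eq_abs]
    refine mul_le_mul_of_nonneg_right (hT.trans ?_) hw0
    calc (56 * M ^ 9 + 20 * M ^ 6) * (y - x) ^ 2 ≤ (56 * M ^ 9 + 20 * M ^ 6) * (9 / 4 * ‖e‖ * ‖s‖) ^ 2 :=
        mul_le_mul_of_nonneg_left hdiff2 hB0
      _ = (56 * M ^ 9 + 20 * M ^ 6) * (81 / 16 * ‖e‖ ^ 2) * ‖s‖ ^ 2 := by ring
  have n2 : ‖((7 * (x⁻¹) ^ 8 - 4 * (x⁻¹) ^ 5) * ‖s‖ ^ 2) • w‖ ≤ (7 * M ^ 8 + 4 * M ^ 5) * ‖s‖ ^ 2 * ‖w‖ := by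
    rw [norm_smul, Real.norm_eq_abs, abs_mul, abs_of_nonneg (sq_nonneg ‖s‖)]
    gcongr
  have n3 : ‖(2 * ⟪s, w⟫ * ((7 * (y⁻¹) ^ 8 - 4 * (y⁻¹) ^ 5) - (7 * (x⁻¹) ^ 8 - 4 * (x⁻¹) ^ 5))) • (e + s)‖ ≤
      2 * (‖s‖ * ‖w‖) * ((56 * M ^ 9 + 20 * M ^ 6) * (9 / 4 * ‖e‖ * ‖s‖)) * (5 / 4 * ‖e‖) := by
    rw [norm_smul, Real.norm_eq_abs, abs_mul, abs_mul, abs_two]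
    have : |(7 * (y⁻¹) ^ 8 - 4 * (y⁻¹) ^ 5) - (7 * (x⁻¹) ^ 8 - 4 * (x⁻¹) ^ 5)| ≤
        (56 * M ^ 9 + 20 * M ^ 6) * (9 / 4 * ‖e‖ * ‖s‖) := hD'.trans (mul_le_mul_of_nonneg_left hdiff hB0)
    gcongr
  have n4 : ‖(2 * ⟪s, w⟫ * (7 * (x⁻¹) ^ 8 - 4 * (x⁻¹) ^ 5)) • s‖ ≤
      2 * (‖s‖ * ‖w‖) * (7 * M ^ 8 + 4 * M ^ 5) * ‖s‖ := by
    rw [norm_smul, Real.norm_eq_abs, abs_mul, abs_mul, abs_two]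
    refine mul_le_mul_of_nonneg_right ?_ hs0
    exact mul_le_mul (mul_le_mul_of_nonneg_left hisw zero_le_two) hh'x (abs_nonneg _) (by positivity)
  have n5 : ‖(2 * ⟪e, w⟫ * ((7 * (y⁻¹) ^ 8 - 4 * (y⁻¹) ^ 5) - (7 * (x⁻¹) ^ 8 - 4 * (x⁻¹) ^ 5) -
        (-56 * (x⁻¹) ^ 9 + 20 * (x⁻¹) ^ 6) * (y - x))) • (e + s)‖ ≤
      2 * (‖e‖ * ‖w‖) * ((504 * M ^ 10 + 120 * M ^ 7) * (81 / 16 * ‖e‖ ^ 2) * ‖s‖ ^ 2) * (5 / 4 * ‖e‖) := by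
    rw [norm_smul, Real.norm_eq_abs, abs_mul, abs_mul, abs_two]
    have : |(7 * (y⁻¹) ^ 8 - 4 * (y⁻¹) ^ 5) - (7 * (x⁻¹) ^ 8 - 4 * (x⁻¹) ^ 5) -
        (-56 * (x⁻¹) ^ 9 + 20 * (x⁻¹) ^ 6) * (y - x)| ≤
        (504 * M ^ 10 + 120 * M ^ 7) * (81 / 16 * ‖e‖ ^ 2) * ‖s‖ ^ 2 := by
      refine hT'.trans ?_
      calc (504 * M ^ 10 + 120 * M ^ 7) * (y - x) ^ 2
          ≤ (504 * M ^ 10 + 120 * M ^ 7) * (9 / 4 * ‖e‖ * ‖s‖) ^ 2 := mul_le_mul_of_nonneg_left hdiff2 hC0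
        _ = (504 * M ^ 10 + 120 * M ^ 7) * (81 / 16 * ‖e‖ ^ 2) * ‖s‖ ^ 2 := by ring
    gcongr
  have n6 : ‖(2 * ⟪e, w⟫ * ((-56 * (x⁻¹) ^ 9 + 20 * (x⁻¹) ^ 6) * ‖s‖ ^ 2)) • (e + s)‖ ≤
      2 * (‖e‖ * ‖w‖) * ((56 * M ^ 9 + 20 * M ^ 6) * ‖s‖ ^ 2) * (5 / 4 * ‖e‖) := by
    rw [norm_smul, Real.norm_eq_abs, abs_mul, abs_mul, abs_two, abs_mul, abs_of_nonneg (sq_nonneg ‖s‖)]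
    gcongr
  have n7 : ‖(2 * ⟪e, w⟫ * ((-56 * (x⁻¹) ^ 9 + 20 * (x⁻¹) ^ 6) * (2 * ⟪e, s⟫))) • s‖ ≤
      2 * (‖e‖ * ‖w‖) * ((56 * M ^ 9 + 20 * M ^ 6) * (2 * (‖e‖ * ‖s‖))) * ‖s‖ := by
    rw [norm_smul, Real.norm_eq_abs, abs_mul, abs_mul, abs_two, abs_mul, abs_mul, abs_two]
    gcongr
  have hsum := norm_add_le_of_le (norm_add_le_of_le (norm_add_le_of_le (norm_add_le_of_le
    (norm_add_le_of_le (norm_add_le_of_le n1 n2) n3) n4) n5) n6) n7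
  refine hsum.trans ?_
  have hscal := taylor_scalar_bound he
  rw [hM] at hscal
  have hpos : 0 ≤ ‖s‖ ^ 2 * ‖w‖ := by positivity
  have key : (56 * M ^ 9 + 20 * M ^ 6) * (81 / 16 * ‖e‖ ^ 2) * ‖s‖ ^ 2 * ‖w‖ +
      (7 * M ^ 8 + 4 * M ^ 5) * ‖s‖ ^ 2 * ‖w‖ +
      2 * (‖s‖ * ‖w‖) * ((56 * M ^ 9 + 20 * M ^ 6) * (9 / 4 * ‖e‖ * ‖s‖)) * (5 / 4 * ‖e‖) +
      2 * (‖s‖ * ‖w‖) * (7 * M ^ 8 + 4 * M ^ 5) * ‖s‖ +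
      2 * (‖e‖ * ‖w‖) * ((504 * M ^ 10 + 120 * M ^ 7) * (81 / 16 * ‖e‖ ^ 2) * ‖s‖ ^ 2) * (5 / 4 * ‖e‖) +
      2 * (‖e‖ * ‖w‖) * ((56 * M ^ 9 + 20 * M ^ 6) * ‖s‖ ^ 2) * (5 / 4 * ‖e‖) +
      2 * (‖e‖ * ‖w‖) * ((56 * M ^ 9 + 20 * M ^ 6) * (2 * (‖e‖ * ‖s‖))) * ‖s‖ =
      ((56 * M ^ 9 + 20 * M ^ 6) * (81 / 16 * ‖e‖ ^ 2) + (7 * M ^ 8 + 4 * M ^ 5) +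
        2 * (56 * M ^ 9 + 20 * M ^ 6) * (9 / 4 * ‖e‖) * (5 / 4 * ‖e‖) + 2 * (7 * M ^ 8 + 4 * M ^ 5) +
        2 * ‖e‖ * ((504 * M ^ 10 + 120 * M ^ 7) * (81 / 16 * ‖e‖ ^ 2)) * (5 / 4 * ‖e‖) +
        2 * ‖e‖ * (56 * M ^ 9 + 20 * M ^ 6) * (5 / 4 * ‖e‖) +
        2 * ‖e‖ * ((56 * M ^ 9 + 20 * M ^ 6) * (2 * ‖e‖))) * (‖s‖ ^ 2 * ‖w‖) := by
    ring
  rw [key]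
  calc _ ≤ 10000000 * (‖e‖⁻¹) ^ 10 * (‖s‖ ^ 2 * ‖w‖) := mul_le_mul_of_nonneg_right hscal hpos
    _ = 10000000 * (‖e‖⁻¹) ^ 10 * ‖s‖ ^ 2 * ‖w‖ := by ring

/-! ## The second and first differences in operator norm -/

/-- **Second difference of the kernel applied to a vector**: for `|e| ≥ 1` and `|a| + |b| ≤ |e|/4`,
`‖K(e+a+b)w − K(e+a)w − K(e+b)w + K(e)w‖ ≤ 2·10⁷·|e|⁻¹⁰(|a| + |b|)²|w|` (the linear Taylor parts are additive
in the shift and cancel). [folklore] -/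
theorem norm_forceConst_diff₂_apply_le {e a b : EuclideanSpace ℝ (Fin 3)} (he : 1 ≤ ‖e‖)
    (hab : ‖a‖ + ‖b‖ ≤ ‖e‖ / 4) (w : EuclideanSpace ℝ (Fin 3)) :
    ‖forceConst (e + a + b) w - forceConst (e + a) w - forceConst (e + b) w + forceConst e w‖ ≤
      20000000 * (‖e‖⁻¹) ^ 10 * (‖a‖ + ‖b‖) ^ 2 * ‖w‖ := by
  have ha0 : 0 ≤ ‖a‖ := norm_nonneg a
  have hb0 : 0 ≤ ‖b‖ := norm_nonneg b
  have ha : ‖a‖ ≤ ‖e‖ / 4 := by linarith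
  have hb : ‖b‖ ≤ ‖e‖ / 4 := by linarith
  have habn : ‖a + b‖ ≤ ‖a‖ + ‖b‖ := norm_add_le a b
  have hab' : ‖a + b‖ ≤ ‖e‖ / 4 := habn.trans hab
  have hsq1 : ‖a + b‖ ^ 2 ≤ (‖a‖ + ‖b‖) ^ 2 := pow_le_pow_left₀ (norm_nonneg _) habn 2
  have hsq2 : ‖a‖ ^ 2 + ‖b‖ ^ 2 ≤ (‖a‖ + ‖b‖) ^ 2 := by nlinarith [mul_nonneg ha0 hb0]
  have h1 := norm_forceConst_taylor_le he hab' w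
  have h2 := norm_forceConst_taylor_le he ha w
  have h3 := norm_forceConst_taylor_le he hb w
  rw [← add_assoc] at h1
  -- the linear parts: `Lin(a+b) = Lin(a) + Lin(b)`
  have hlin : ((7 * ((‖e‖ ^ 2)⁻¹) ^ 8 - 4 * ((‖e‖ ^ 2)⁻¹) ^ 5) * (2 * ⟪e, a + b⟫)) • w +
        (2 * ⟪a + b, w⟫ * (7 * ((‖e‖ ^ 2)⁻¹) ^ 8 - 4 * ((‖e‖ ^ 2)⁻¹) ^ 5)) • e +
        (2 * ⟪e, w⟫ * ((-56 * ((‖e‖ ^ 2)⁻¹) ^ 9 + 20 * ((‖e‖ ^ 2)⁻¹) ^ 6) * (2 * ⟪e, a + b⟫))) • e +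
        (2 * ⟪e, w⟫ * (7 * ((‖e‖ ^ 2)⁻¹) ^ 8 - 4 * ((‖e‖ ^ 2)⁻¹) ^ 5)) • (a + b) =
      (((7 * ((‖e‖ ^ 2)⁻¹) ^ 8 - 4 * ((‖e‖ ^ 2)⁻¹) ^ 5) * (2 * ⟪e, a⟫)) • w +
        (2 * ⟪a, w⟫ * (7 * ((‖e‖ ^ 2)⁻¹) ^ 8 - 4 * ((‖e‖ ^ 2)⁻¹) ^ 5)) • e +
        (2 * ⟪e, w⟫ * ((-56 * ((‖e‖ ^ 2)⁻¹) ^ 9 + 20 * ((‖e‖ ^ 2)⁻¹) ^ 6) * (2 * ⟪e, a⟫))) • e +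
        (2 * ⟪e, w⟫ * (7 * ((‖e‖ ^ 2)⁻¹) ^ 8 - 4 * ((‖e‖ ^ 2)⁻¹) ^ 5)) • a) +
      (((7 * ((‖e‖ ^ 2)⁻¹) ^ 8 - 4 * ((‖e‖ ^ 2)⁻¹) ^ 5) * (2 * ⟪e, b⟫)) • w +
        (2 * ⟪b, w⟫ * (7 * ((‖e‖ ^ 2)⁻¹) ^ 8 - 4 * ((‖e‖ ^ 2)⁻¹) ^ 5)) • e +
        (2 * ⟪e, w⟫ * ((-56 * ((‖e‖ ^ 2)⁻¹) ^ 9 + 20 * ((‖e‖ ^ 2)⁻¹) ^ 6) * (2 * ⟪e, b⟫))) • e +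
        (2 * ⟪e, w⟫ * (7 * ((‖e‖ ^ 2)⁻¹) ^ 8 - 4 * ((‖e‖ ^ 2)⁻¹) ^ 5)) • b) := by
    rw [inner_add_right, inner_add_left]
    module
  rw [hlin] at h1
  have key : forceConst (e + a + b) w - forceConst (e + a) w - forceConst (e + b) w + forceConst e w =
      (forceConst (e + a + b) w - forceConst e w -
        ((((7 * ((‖e‖ ^ 2)⁻¹) ^ 8 - 4 * ((‖e‖ ^ 2)⁻¹) ^ 5) * (2 * ⟪e, a⟫)) • w +
          (2 * ⟪a, w⟫ * (7 * ((‖e‖ ^ 2)⁻¹) ^ 8 - 4 * ((‖e‖ ^ 2)⁻¹) ^ 5)) • e +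
          (2 * ⟪e, w⟫ * ((-56 * ((‖e‖ ^ 2)⁻¹) ^ 9 + 20 * ((‖e‖ ^ 2)⁻¹) ^ 6) * (2 * ⟪e, a⟫))) • e +
          (2 * ⟪e, w⟫ * (7 * ((‖e‖ ^ 2)⁻¹) ^ 8 - 4 * ((‖e‖ ^ 2)⁻¹) ^ 5)) • a) +
        (((7 * ((‖e‖ ^ 2)⁻¹) ^ 8 - 4 * ((‖e‖ ^ 2)⁻¹) ^ 5) * (2 * ⟪e, b⟫)) • w +
          (2 * ⟪b, w⟫ * (7 * ((‖e‖ ^ 2)⁻¹) ^ 8 - 4 * ((‖e‖ ^ 2)⁻¹) ^ 5)) • e +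
          (2 * ⟪e, w⟫ * ((-56 * ((‖e‖ ^ 2)⁻¹) ^ 9 + 20 * ((‖e‖ ^ 2)⁻¹) ^ 6) * (2 * ⟪e, b⟫))) • e +
          (2 * ⟪e, w⟫ * (7 * ((‖e‖ ^ 2)⁻¹) ^ 8 - 4 * ((‖e‖ ^ 2)⁻¹) ^ 5)) • b))) -
      (forceConst (e + a) w - forceConst e w -
        (((7 * ((‖e‖ ^ 2)⁻¹) ^ 8 - 4 * ((‖e‖ ^ 2)⁻¹) ^ 5) * (2 * ⟪e, a⟫)) • w +
          (2 * ⟪a, w⟫ * (7 * ((‖e‖ ^ 2)⁻¹) ^ 8 - 4 * ((‖e‖ ^ 2)⁻¹) ^ 5)) • e +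
          (2 * ⟪e, w⟫ * ((-56 * ((‖e‖ ^ 2)⁻¹) ^ 9 + 20 * ((‖e‖ ^ 2)⁻¹) ^ 6) * (2 * ⟪e, a⟫))) • e +
          (2 * ⟪e, w⟫ * (7 * ((‖e‖ ^ 2)⁻¹) ^ 8 - 4 * ((‖e‖ ^ 2)⁻¹) ^ 5)) • a)) -
      (forceConst (e + b) w - forceConst e w -
        (((7 * ((‖e‖ ^ 2)⁻¹) ^ 8 - 4 * ((‖e‖ ^ 2)⁻¹) ^ 5) * (2 * ⟪e, b⟫)) • w +
          (2 * ⟪b, w⟫ * (7 * ((‖e‖ ^ 2)⁻¹) ^ 8 - 4 * ((‖e‖ ^ 2)⁻¹) ^ 5)) • e +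
          (2 * ⟪e, w⟫ * ((-56 * ((‖e‖ ^ 2)⁻¹) ^ 9 + 20 * ((‖e‖ ^ 2)⁻¹) ^ 6) * (2 * ⟪e, b⟫))) • e +
          (2 * ⟪e, w⟫ * (7 * ((‖e‖ ^ 2)⁻¹) ^ 8 - 4 * ((‖e‖ ^ 2)⁻¹) ^ 5)) • b)) := by
    abel
  rw [key]
  refine (norm_sub_le_of_le (norm_sub_le_of_le h1 h2) h3).trans ?_
  have hu0 : 0 ≤ (‖e‖⁻¹) ^ 10 := by positivity
  have hK : 0 ≤ 10000000 * (‖e‖⁻¹) ^ 10 * ‖w‖ := by positivity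
  calc 10000000 * (‖e‖⁻¹) ^ 10 * ‖a + b‖ ^ 2 * ‖w‖ + 10000000 * (‖e‖⁻¹) ^ 10 * ‖a‖ ^ 2 * ‖w‖ +
        10000000 * (‖e‖⁻¹) ^ 10 * ‖b‖ ^ 2 * ‖w‖
      = 10000000 * (‖e‖⁻¹) ^ 10 * ‖w‖ * (‖a + b‖ ^ 2 + (‖a‖ ^ 2 + ‖b‖ ^ 2)) := by ring
    _ ≤ 10000000 * (‖e‖⁻¹) ^ 10 * ‖w‖ * ((‖a‖ + ‖b‖) ^ 2 + (‖a‖ + ‖b‖) ^ 2) := by gcongr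
    _ = 20000000 * (‖e‖⁻¹) ^ 10 * (‖a‖ + ‖b‖) ^ 2 * ‖w‖ := by ring

/-- **Second difference of the kernel in operator norm**: for `|e| ≥ 1` and `|a| + |b| ≤ |e|/4`,
`‖K(e+a+b) − K(e+a) − K(e+b) + K(e)‖ ≤ 2·10⁷·|e|⁻¹⁰(|a| + |b|)²`. [folklore] -/
theorem norm_forceConst_diff₂_le {e a b : EuclideanSpace ℝ (Fin 3)} (he : 1 ≤ ‖e‖)
    (hab : ‖a‖ + ‖b‖ ≤ ‖e‖ / 4) :
    ‖forceConst (e + a + b) - forceConst (e + a) - forceConst (e + b) + forceConst e‖ ≤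
      20000000 * (‖e‖⁻¹) ^ 10 * (‖a‖ + ‖b‖) ^ 2 := by
  refine ContinuousLinearMap.opNorm_le_bound _ (by positivity) fun w => ?_
  simp only [add_apply, sub_apply]
  exact norm_forceConst_diff₂_apply_le he hab w

/-- **First difference of the kernel in operator norm** (`norm_forceConst_shift_sub_le` of the sister item,
restated for the CLM `forceConst`): for `|e| ≥ 9/10` and `|a| ≤ |e|/4`, `‖K(e+a) − K(e)‖ ≤ 2·10⁵·|e|⁻⁹|a|`.
[folklore] -/
theorem norm_forceConst_diff₁_le {e a : EuclideanSpace ℝ (Fin 3)} (he : 9 / 10 ≤ ‖e‖) (ha : ‖a‖ ≤ ‖e‖ / 4) :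
    ‖forceConst (e + a) - forceConst e‖ ≤ 200000 * (‖e‖⁻¹) ^ 9 * ‖a‖ := by
  refine ContinuousLinearMap.opNorm_le_bound _ (by positivity) fun w => ?_
  rw [sub_apply, forceConst_apply, forceConst_apply]
  exact norm_forceConst_shift_sub_le he ha w

end Blowdown

/-- Registered carrier of this helper file (crux stmt-AtomisticToContinuum-9332, line `Sketch` v4, stub
`stub_interior`, step (3)): the second difference of the force-constant kernel decays like `|e|⁻¹⁰`,
`‖K(e+a+b) − K(e+a) − K(e+b) + K(e)‖ ≤ 2·10⁷·|e|⁻¹⁰(|a| + |b|)²` for `|e| ≥ 1`, `|a| + |b| ≤ |e|/4`. [folklore] -/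
theorem blowdown_kernelDiff : ∀ (e a b : (EuclideanSpace ℝ (Fin 3))), 1 ≤ ‖e‖ → ‖a‖ + ‖b‖ ≤ ‖e‖ / 4 →
    ‖forceConst (e + a + b) - forceConst (e + a) - forceConst (e + b) + forceConst e‖ ≤
      20000000 * (‖e‖⁻¹) ^ 10 * (‖a‖ + ‖b‖) ^ 2 :=
  fun _ _ _ he hab => Blowdown.norm_forceConst_diff₂_le he hab

end Summit.AtomisticToContinuum.Crystallization.Theorems.ExcessDecayLiouville

end
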